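import Summits.NavierStokesRegularity.FluidComputer.PalasekTowerTinyBlobProfile
import Summits.NavierStokesRegularity.FluidComputer.PalasekTowerMatchedGerm
import Literature.Analysis.FluidPDE.RadialCalculus
import Literature.Analysis.FluidPDE.HessianLaplacian

/-!
# The tiny blob, II: the field `B_a(y) = F(‖y‖²/a²) e₃ − (y₃ G(‖y‖²/a²)/a²) y` — smooth, compactly
# supported, divergence free, even, flat at the centre, with a unique unit speed maximum at `0`

Cell `ns-blowup`, seat `ns-blowup-ecbridge-4` (g3); GROUP C «BRIDGE SUPPORT» of the route
`PalasekTowerBreakdown` (crux `EpisodeBaseG`, item stmt-NavierStokesRegularity-19179; negative lane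
`TinyAnchoredHosts` of `PalasekTowerRegisterGlobalSmallData.lean`). Sequel of
`PalasekTowerTinyBlobProfile.lean` (`blobF`, `blobG`, `etaProf`). LABEL: E–C typing (KERNEL calculus:
two definitions with bodies — the unit vector `e₃` and the blob field — and their properties). WHAT THIS
IS NOT: not Navier–Stokes evidence — a vector field and its calculus; no flow, stage or schedule.

## The field

`tinyBlob a y = blobF (‖y‖²/a²) • e₃ − (y₂ · blobG (‖y‖²/a²) / a²) • y` (`y₂` = third coordinate), i.e.
`B(y/a)` for the unit blob `B(y) = F(σ) e₃ − y₃ G(σ) y` (`= curl(η(σ) · ½ e₃ × y)`, `σ = ‖y‖²`). Proved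
here, for `a > 0`:

* `contDiff_tinyBlob`, `tinyBlob_zero = e₃`, `tinyBlob_neg` (EVEN), `tinyBlob_eq_zero_of_le`
  (vanishes for `‖y‖² ≥ (3/2)a²`), `tsupport_tinyBlob_subset` (`⊆ B̄(0, 2a)`);
* `norm_tinyBlob_sq` (`‖B‖² = F² − (y₂²/a²) G (2F − sG)`, `s = ‖y‖²/a²`), `norm_tinyBlob_le_one`,
  `norm_tinyBlob_lt_one` (`y ≠ 0`), `norm_tinyBlob_eq_one_iff` — the UNIQUE speed maximum at the centre;
* `hasFDerivAt_tinyBlob`, `isDivFree_tinyBlob` (`div B = (y₂/a²)(4G + 2sG′ − 3G − (G + 2sG′)) = 0`),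
  `fderiv_tinyBlob_zero = 0`, `laplacian_tinyBlob_zero = 0` (FLAT at the centre: `F′(0) = G(0) = 0`),
  `exists_fderiv_tinyBlob_ne_zero` (a nonconstant field has a nonzero derivative in `B(0, 2a)`).

References: folklore vector calculus; the construction serves S. Palasek, arXiv:2605.13827 §3.3
(level-`0` host of a tower) [cite: Palasek2026ElementaryModel, §3.3].
-/

noncomputable section

namespace Summit.NavierStokesRegularity.FluidComputer.PalasekTowerClayBridge.TinyBlob

open Set Function Filter Topology InnerProductSpace Metric MeasureTheory
open scoped Topology ContDiff RealInnerProductSpace Laplacian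

open Literature.Analysis.FluidPDE

/-- The third unit vector `e₃` of `ℝ³`. [folklore] -/
def e₃ : EuclideanSpace ℝ (Fin 3) := EuclideanSpace.single 2 1

/-- **The tiny blob of scale `a`**: `B_a(y) = F(‖y‖²/a²) • e₃ − (y₂ G(‖y‖²/a²)/a²) • y`. [folklore] -/
def tinyBlob (a : ℝ) (y : EuclideanSpace ℝ (Fin 3)) : EuclideanSpace ℝ (Fin 3) :=
  blobF (‖y‖ ^ 2 / a ^ 2) • e₃ - (y 2 * blobG (‖y‖ ^ 2 / a ^ 2) / a ^ 2) • y

/-! ## §1 The unit vector and the scaled square norm -/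

/-- `‖e₃‖ = 1`. [folklore] -/
theorem norm_e₃ : ‖e₃‖ = 1 := by simp [e₃]

/-- `⟪e₃, y⟫ = y₂`. [folklore] -/
theorem inner_e₃_left (y : EuclideanSpace ℝ (Fin 3)) : ⟪e₃, y⟫ = y 2 := by
  simp [e₃, EuclideanSpace.inner_single_left]

/-- `⟪y, e₃⟫ = y₂`. [folklore] -/
theorem inner_e₃_right (y : EuclideanSpace ℝ (Fin 3)) : ⟪y, e₃⟫ = y 2 := by
  rw [real_inner_comm, inner_e₃_left]

/-- `(e₃)₂ = 1`. [folklore] -/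
theorem e₃_apply_two : e₃ 2 = 1 := by simp [e₃]

variable {a : ℝ}

/-- The scaled square norm `s(y) = ‖y‖²/a²`. [folklore] -/
def sqn (a : ℝ) (y : EuclideanSpace ℝ (Fin 3)) : ℝ := ‖y‖ ^ 2 / a ^ 2

/-- `s` is smooth. [folklore] -/
theorem contDiff_sqn (a : ℝ) : ContDiff ℝ ∞ (sqn a) :=
  (contDiff_norm_sq ℝ).div_const _

/-- `Ds(y) = (2/a²) ⟪y, ·⟫`. [folklore] -/
theorem hasFDerivAt_sqn (a : ℝ) (y : EuclideanSpace ℝ (Fin 3)) :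
    HasFDerivAt (sqn a) ((2 / a ^ 2) • innerSL ℝ y) y := by
  have h : HasFDerivAt (fun y : EuclideanSpace ℝ (Fin 3) => ‖y‖ ^ 2) (2 • innerSL ℝ y) y := by
    have := (hasFDerivAt_id y).norm_sq
    simpa using this
  have h2 : HasFDerivAt (fun y : EuclideanSpace ℝ (Fin 3) => (a ^ 2)⁻¹ * ‖y‖ ^ 2)
      ((a ^ 2)⁻¹ • (2 • innerSL ℝ y)) y := h.const_mul _
  have htwo : (2 • innerSL ℝ y : EuclideanSpace ℝ (Fin 3) →L[ℝ] ℝ) = innerSL ℝ y + innerSL ℝ y :=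
    two_nsmul _
  rw [htwo] at h2
  have hfun : sqn a = fun y : EuclideanSpace ℝ (Fin 3) => (a ^ 2)⁻¹ * ‖y‖ ^ 2 := by
    funext y; rw [sqn, div_eq_inv_mul]
  have hclm : ((2 / a ^ 2) • innerSL ℝ y : EuclideanSpace ℝ (Fin 3) →L[ℝ] ℝ) =
      (a ^ 2)⁻¹ • (innerSL ℝ y + innerSL ℝ y) := by
    ext v
    simp only [smul_apply, add_apply, smul_eq_mul]
    ring
  rw [hfun, hclm]
  exact h2

/-- `s(0) = 0`. [folklore] -/
theorem sqn_zero (a : ℝ) : sqn a 0 = 0 := by simp [sqn]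

/-- `s(−y) = s(y)`. [folklore] -/
theorem sqn_neg (a : ℝ) (y : EuclideanSpace ℝ (Fin 3)) : sqn a (-y) = sqn a y := by simp [sqn]

/-- `0 ≤ s`. [folklore] -/
theorem sqn_nonneg (a : ℝ) (y : EuclideanSpace ℝ (Fin 3)) : 0 ≤ sqn a y := by
  unfold sqn; positivity

/-- `0 < s(y)` for `y ≠ 0`, `a ≠ 0`. [folklore] -/
theorem sqn_pos (ha : a ≠ 0) {y : EuclideanSpace ℝ (Fin 3)} (hy : y ≠ 0) : 0 < sqn a y := by
  unfold sqn
  exact div_pos (by positivity) (by positivity)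

/-- The blob in terms of `s`. [folklore] -/
theorem tinyBlob_eq (a : ℝ) (y : EuclideanSpace ℝ (Fin 3)) :
    tinyBlob a y = blobF (sqn a y) • e₃ - (y 2 * blobG (sqn a y) / a ^ 2) • y := rfl

/-! ## §2 Smoothness, the centre, evenness, support -/

/-- **The blob is smooth.** [folklore] -/
theorem contDiff_tinyBlob (a : ℝ) : ContDiff ℝ ∞ (tinyBlob a) := by
  have hs := contDiff_sqn a
  have h2 : ContDiff ℝ ∞ fun y : EuclideanSpace ℝ (Fin 3) => y 2 :=
    (EuclideanSpace.proj (2 : Fin 3) : EuclideanSpace ℝ (Fin 3) →L[ℝ] ℝ).contDiff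
  show ContDiff ℝ ∞ fun y => blobF (sqn a y) • e₃ - (y 2 * blobG (sqn a y) / a ^ 2) • y
  exact ((contDiff_blobF.comp hs).smul contDiff_const).sub
    (((h2.mul (contDiff_blobG.comp hs)).div_const _).smul contDiff_id)

/-- The blob is differentiable. [folklore] -/
theorem differentiable_tinyBlob (a : ℝ) : Differentiable ℝ (tinyBlob a) :=
  (contDiff_tinyBlob a).differentiable (by simp)

/-- **`B_a(0) = e₃`.** [folklore] -/
theorem tinyBlob_zero (a : ℝ) : tinyBlob a 0 = e₃ := by
  rw [tinyBlob_eq, sqn_zero, blobF_zero]; simp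

/-- `‖B_a(0)‖ = 1`. [folklore] -/
theorem norm_tinyBlob_zero (a : ℝ) : ‖tinyBlob a 0‖ = 1 := by rw [tinyBlob_zero, norm_e₃]

/-- **The blob is EVEN**: `B_a(−y) = B_a(y)`. [folklore] -/
theorem tinyBlob_neg (a : ℝ) (y : EuclideanSpace ℝ (Fin 3)) : tinyBlob a (-y) = tinyBlob a y := by
  rw [tinyBlob_eq, tinyBlob_eq, sqn_neg]
  simp only [PiLp.neg_apply, neg_mul, neg_div, smul_neg, neg_smul, neg_neg]

/-- The blob vanishes where `s ≥ 3/2`. [folklore] -/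
theorem tinyBlob_eq_zero_of_le {y : EuclideanSpace ℝ (Fin 3)} (h : 3 / 2 ≤ sqn a y) : tinyBlob a y = 0 := by
  rw [tinyBlob_eq, blobF_of_ge h, blobG_of_ge h]; simp

/-- For `a > 0` and `‖y‖ > 2a` one has `s(y) ≥ 3/2`. [folklore] -/
theorem sqn_ge_of_norm_gt (ha : 0 < a) {y : EuclideanSpace ℝ (Fin 3)} (hy : 2 * a < ‖y‖) :
    3 / 2 ≤ sqn a y := by
  unfold sqn
  rw [le_div_iff₀ (by positivity)]
  nlinarith [norm_nonneg y]

/-- **Confinement**: the blob vanishes outside `B̄(0, 2a)` (`a > 0`). [folklore] -/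
theorem tinyBlob_eq_zero_of_norm_gt (ha : 0 < a) {y : EuclideanSpace ℝ (Fin 3)} (hy : 2 * a < ‖y‖) :
    tinyBlob a y = 0 :=
  tinyBlob_eq_zero_of_le (sqn_ge_of_norm_gt ha hy)

/-- **Support**: `tsupport B_a ⊆ B̄(0, 2a)` (`a > 0`). [folklore] -/
theorem tsupport_tinyBlob_subset (ha : 0 < a) :
    tsupport (tinyBlob a) ⊆ closedBall (0 : EuclideanSpace ℝ (Fin 3)) (2 * a) := by
  refine closure_minimal (fun y hy => ?_) isClosed_closedBall
  rw [mem_closedBall, dist_zero_right]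
  by_contra h
  exact hy (tinyBlob_eq_zero_of_norm_gt ha (not_le.1 h))

/-- The blob has compact support (`a > 0`). [folklore] -/
theorem hasCompactSupport_tinyBlob (ha : 0 < a) : HasCompactSupport (tinyBlob a) :=
  (isCompact_closedBall (0 : EuclideanSpace ℝ (Fin 3)) (2 * a)).of_isClosed_subset (isClosed_tsupport _)
    (tsupport_tinyBlob_subset ha)

/-! ## §3 The speed: `‖B‖² ≤ max(F², η²)`, unique unit maximum at the centre -/

/-- **The square of the speed**: `‖B_a(y)‖² = F² − (y₂²/a²) · G · (2F − s G)` at `s = s(y)`. [folklore] -/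
theorem norm_tinyBlob_sq (ha : a ≠ 0) (y : EuclideanSpace ℝ (Fin 3)) :
    ‖tinyBlob a y‖ ^ 2 = blobF (sqn a y) ^ 2 -
      (y 2) ^ 2 / a ^ 2 * blobG (sqn a y) * (2 * blobF (sqn a y) - sqn a y * blobG (sqn a y)) := by
  rw [tinyBlob_eq, norm_sub_sq_real, norm_smul, norm_e₃, mul_one, Real.norm_eq_abs, sq_abs,
    inner_smul_left, inner_smul_right, inner_e₃_left, norm_smul, mul_pow, Real.norm_eq_abs, sq_abs]
  have hs : ‖y‖ ^ 2 = a ^ 2 * sqn a y := by unfold sqn; field_simp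
  rw [hs]
  simp only [starRingEnd_apply, star_trivial]
  field_simp
  ring

/-- **`‖B‖² ≤ max(F², η²)`** (the expression is affine in `y₂² ∈ [0, ‖y‖²]`; at the endpoint
`y₂² = ‖y‖²` it equals `(F − sG)² = η²`). [folklore] -/
theorem norm_tinyBlob_sq_le (ha : a ≠ 0) (y : EuclideanSpace ℝ (Fin 3)) :
    ‖tinyBlob a y‖ ^ 2 ≤ max (blobF (sqn a y) ^ 2) (etaProf (sqn a y) ^ 2) := by
  rw [norm_tinyBlob_sq ha]
  set s := sqn a y
  set Q := blobG s * (2 * blobF s - s * blobG s) with hQ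
  have hη : etaProf s = blobF s - s * blobG s := by rw [blobF]; ring
  have ht0 : 0 ≤ (y 2) ^ 2 / a ^ 2 := by positivity
  have hts : (y 2) ^ 2 / a ^ 2 ≤ s := by
    show (y 2) ^ 2 / a ^ 2 ≤ ‖y‖ ^ 2 / a ^ 2
    refine div_le_div_of_nonneg_right ?_ (by positivity)
    have h := EuclideanSpace.norm_sq_eq y
    rw [h, Fin.sum_univ_three]
    simp only [Real.norm_eq_abs, sq_abs]
    nlinarith [sq_nonneg (y 0), sq_nonneg (y 1)]
  have hend : blobF s ^ 2 - s * Q = etaProf s ^ 2 := by rw [hη, hQ]; ring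
  have key : blobF s ^ 2 - (y 2) ^ 2 / a ^ 2 * blobG s * (2 * blobF s - s * blobG s) =
      blobF s ^ 2 - (y 2) ^ 2 / a ^ 2 * Q := by rw [hQ]; ring
  rw [key]
  rcases le_or_gt 0 Q with hQ0 | hQ0
  · exact le_trans (by nlinarith [mul_nonneg ht0 hQ0]) (le_max_left _ _)
  · refine le_trans ?_ (le_max_right _ _)
    rw [← hend]
    nlinarith [mul_le_mul_of_nonpos_right hts hQ0.le]

/-- **Speed ceiling**: `‖B_a(y)‖ ≤ 1`. [folklore] -/
theorem norm_tinyBlob_le_one (ha : a ≠ 0) (y : EuclideanSpace ℝ (Fin 3)) : ‖tinyBlob a y‖ ≤ 1 := by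
  have h := (norm_tinyBlob_sq_le ha y).trans (max_sq_le_one (sqn_nonneg a y))
  nlinarith [norm_nonneg (tinyBlob a y)]

/-- **The maximum is strict off the centre**: `‖B_a(y)‖ < 1` for `y ≠ 0`. [folklore] -/
theorem norm_tinyBlob_lt_one (ha : a ≠ 0) {y : EuclideanSpace ℝ (Fin 3)} (hy : y ≠ 0) :
    ‖tinyBlob a y‖ < 1 := by
  have h := lt_of_le_of_lt (norm_tinyBlob_sq_le ha y) (max_sq_lt_one (sqn_pos ha hy))
  nlinarith [norm_nonneg (tinyBlob a y)]

/-- **UNIQUE unit speed maximum**: `‖B_a(y)‖ = 1 ↔ y = 0`. [folklore] -/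
theorem norm_tinyBlob_eq_one_iff (ha : a ≠ 0) {y : EuclideanSpace ℝ (Fin 3)} :
    ‖tinyBlob a y‖ = 1 ↔ y = 0 := by
  refine ⟨fun h => ?_, fun h => by rw [h, norm_tinyBlob_zero]⟩
  by_contra hy
  exact absurd h (norm_tinyBlob_lt_one ha hy).ne

end Summit.NavierStokesRegularity.FluidComputer.PalasekTowerClayBridge.TinyBlob

end
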